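import Summits.ABC.IUTFork.Cor312GenuineKTpdFibre
import Summits.ABC.IUTFork.BrobergPoint
import Summits.ABC.IUTFork.Cor312ProvKRamified
import HarnessLib

/-!
# R-W WINDOW-TABLE rows 9/10 (Broberg `ℚ(√7)`): the fibre shape of the `K`-level datum of EVERY genuine Θ-volume datum at Broberg's point —
# the type map and the hypotheses `hbad / h3 / h47 / hiso` of the mixed-fibre row theorems, DERIVED

PROOF-ONLY file (D-0012; 0 definitions, 0 `Prop` facts) of the abc-iut cell — D-0079 RESCUE sub-cell R-W «WINDOW Θ-SIDE INEQUALITY», W1 ROW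
DECISIONS seat abc-iut-W-row-2 (gen 3). The gen-2 row files `Conditional/WRowBrobergMixedSeven.lean` / `…Eleven.lean` (p486684 / p486925)
decide rows 9/10 of HOME/plan/rescue/R-W/OPEN-10.md INHABITED over abc-iut-w5-d180's mixed-fibre socket for ANY pilot data with the Broberg
fibre shape taken BY NAME: a type map `c`, indices `eA ∈ 10l·ℕ`, `eB ∈ 30l·ℕ`, `eC ∈ 15l·ℕ`, and the hypotheses `hbad` (bad places over `3`, `47`
only), `h3` / `h47` (type ⇒ `(e, P_q)`), `hiso` (same type ⇒ `ℚ_p`-isomorphic completions). THIS FILE derives all of them for the `K`-level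
datum `X := pilotDataOfK T.D T.K` of EVERY genuine Θ-volume datum `T : Cor22.ThetaVolumeDatumAt Broberg.point l` ([IUTchIV] Cor. 2.2 (ii) proof
(P7)), at every level `l`:

* **`WRow.exists_brobergTypes`** — `∃ c eA eB eC` with `10l ∣ eA`, `30l ∣ eB`, `15l ∣ eC`, `hbad`, `h3` (`P_q = 12·eA/l` resp. `eB/l`), `h47`
  (`P_q = 4·eC/l`), `hiso` — in exactly the binder shapes of `WRow.licence_of_brobergTypes_seven / _eleven`.
HOW (numbers, names): a bad fibre point `x | p` lies over a place `v` of `F_tpd = ℚ(√7)` that is a pole of `j(λ)` away from `2`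
(`GenuineK.finBelow_tpd_mem_badPlaces`, `Cor312GenuineKTpdFibre`), hence `v ∈ {𝔭₃, 𝔭₃', 𝔭₄₇}` with `ord_v j(λ) = −2, −24, −8` and `e(v|p) = 1`
(`BrobergPoint`); so `p ∈ {3, 47}`, the TYPE of `x` is `v` (`c x := 1` iff `v = 𝔭₃`), fibre points of one type are conjugate under `Gal(K/F_tpd)`
(`GenuineK.isGalois_tpd_K`: isometric completions, equal `e`), `P_q(x) = e·h/(2l)` (`GenuineK.qPilot_placeOf_eq_of_ord_tpd`), and `e = l·m` with
`30 ∣ m·h` (`GenuineK.exists_absRamificationIdx_kOf_eq_prime_mul_tpd`), `2 ∣ e` over `3` (`ζ_3 ∈ F`, `GenuineK.sub_one_dvd_absRamificationIdx_kOf`)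
⇒ `e ∈ 10l·ℕ / 30l·ℕ / 15l·ℕ` at `h = 24 / 2 / 8`. READING (neutral): bookkeeping of OUR typed data; NON-EMPTINESS of the datum type, admissibility
and Szpiro-badness of `(Broberg.point, l)` are NOT claimed; nothing here bears on the truth of [IUTchIII] Cor. 3.12; typed ≠ proved; instantiated
≠ endorsed; no abc claim. [cite: Mochizuki2012, IUTchI Def. 3.1 (b),(c) pp. 61–62, Rmk. 3.1.5 p. 65, Ex. 3.2 (iv) p. 71; IUTchIV Cor. 2.2 (ii) proof (P5),(P7) p. 46]
[cite: DupuyHilado2025, §3.3, §3.4] [cite: CasselsFrohlichANT1967, Ch. VII Prop. 1.2 (ii)] [cite: NeukirchANT1999, Ch. I (8.2)]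
[claim: Mochizuki2012, status: disputed] for every IUT sentence.
-/

noncomputable section

open NumberField IsDedekindDomain

namespace Summit.ABC.IUTFork.Conditional

open Thm311 Thm311.Real Cor312 Cor312Prov Literature.IUT.LogVolume Literature.IUT.HodgeTheaters
  Literature.IUT.LogThetaLattice Literature.NumberTheory.NumberFields Literature.NumberTheory.DiophantineGeometry.GenEll
  Literature.NumberTheory.DiophantineGeometry Summit.ABC.IUTFork.Sqrt7 Summit.ABC.IUTFork.Broberg

/-- **THE BROBERG FIBRE SHAPE, DERIVED.** For EVERY genuine Θ-volume datum `T` at `(Broberg.point, l)` and `X := pilotDataOfK T.D T.K` there are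
a type map `c` on the fibres and indices `eA, eB, eC` with `10l ∣ eA`, `30l ∣ eB`, `15l ∣ eC` such that: every bad fibre point lies over `3` or
`47` (`hbad`); over `3`, type `0` has `e(K_x/ℚ_3) = eA`, `P_q(x) = 12·eA/l` and type `1` has `e = eB`, `P_q(x) = eB/l` (`h3`); over `47` there is
one type with `e = eC`, `P_q(x) = 4·eC/l` (`h47`); bad fibre points of the same type have `ℚ_p`-isomorphic completions (`hiso`) — the hypotheses of
`WRow.licence_of_brobergTypes_seven / _eleven`, discharged. (`c x = 1` iff `x` lies over `𝔭₃ = (2+√7)`, the `h = 2` place; `eA, eB, eC` are the actual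
indices at a bad point of each type, or `10l, 30l, 15l` if the type is empty.)
[cite: Mochizuki2012, IUTchI Rmk. 3.1.5 p. 65, Ex. 3.2 (iv) p. 71; IUTchIV Cor. 2.2 (ii) proof (P5),(P7) p. 46] [cite: DupuyHilado2025, §3.3, §3.4]
[claim: Mochizuki2012, status: disputed] -/
theorem WRow.exists_brobergTypes {l : ℕ} (T : Cor22.ThetaVolumeDatumAt Broberg.point l) :
    letI := T.instFieldF; letI := T.instNumberFieldF; letI := T.instAlgebraF; letI := T.instFieldK
    letI := T.instNumberFieldK; letI := T.instAlgebraK; letI := T.instFieldFbar; letI := T.instAlgebraFbar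
    letI := T.instAlgebraKFbar; letI := T.instIsElliptic
    ∃ (c : ∀ pp : Nat.Primes, (thetaIndex (pilotDataOfK T.D T.K)).Fibre (.inr pp) → Fin 2) (eA eB eC : ℕ),
      10 * l ∣ eA ∧ 30 * l ∣ eB ∧ 15 * l ∣ eC ∧
      (∀ (pp : Nat.Primes) (x : (thetaIndex (pilotDataOfK T.D T.K)).Fibre (.inr pp)), haveI : Fact (pp : ℕ).Prime := ⟨pp.2⟩
        placeOf (pilotDataOfK T.D T.K) pp.1 x ∈ (pilotDataOfK T.D T.K).S → (pp : ℕ) = 3 ∨ (pp : ℕ) = 47) ∧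
      (∀ (pp : Nat.Primes) (x : (thetaIndex (pilotDataOfK T.D T.K)).Fibre (.inr pp)), haveI : Fact (pp : ℕ).Prime := ⟨pp.2⟩
        (pp : ℕ) = 3 → placeOf (pilotDataOfK T.D T.K) pp.1 x ∈ (pilotDataOfK T.D T.K).S →
          (c pp x = 0 → absRamificationIdx (pp : ℕ) (kOf (pilotDataOfK T.D T.K) pp.1 x) = eA ∧
            (pilotDataOfK T.D T.K).qPilot (placeOf (pilotDataOfK T.D T.K) pp.1 x) = ((12 * eA / l : ℕ) : ℝ)) ∧
          (c pp x = 1 → absRamificationIdx (pp : ℕ) (kOf (pilotDataOfK T.D T.K) pp.1 x) = eB ∧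
            (pilotDataOfK T.D T.K).qPilot (placeOf (pilotDataOfK T.D T.K) pp.1 x) = ((eB / l : ℕ) : ℝ))) ∧
      (∀ (pp : Nat.Primes) (x : (thetaIndex (pilotDataOfK T.D T.K)).Fibre (.inr pp)), haveI : Fact (pp : ℕ).Prime := ⟨pp.2⟩
        (pp : ℕ) = 47 → placeOf (pilotDataOfK T.D T.K) pp.1 x ∈ (pilotDataOfK T.D T.K).S →
          c pp x = 0 ∧ absRamificationIdx (pp : ℕ) (kOf (pilotDataOfK T.D T.K) pp.1 x) = eC ∧
            (pilotDataOfK T.D T.K).qPilot (placeOf (pilotDataOfK T.D T.K) pp.1 x) = ((4 * eC / l : ℕ) : ℝ)) ∧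
      (∀ (pp : Nat.Primes) (x y : (thetaIndex (pilotDataOfK T.D T.K)).Fibre (.inr pp)), haveI : Fact (pp : ℕ).Prime := ⟨pp.2⟩
        placeOf (pilotDataOfK T.D T.K) pp.1 x ∈ (pilotDataOfK T.D T.K).S → placeOf (pilotDataOfK T.D T.K) pp.1 y ∈ (pilotDataOfK T.D T.K).S →
          c pp x = c pp y → Nonempty (kOf (pilotDataOfK T.D T.K) pp.1 x ≃ₐ[ℚ_[pp]] kOf (pilotDataOfK T.D T.K) pp.1 y)) := by
  classical
  letI := T.instFieldF; letI := T.instNumberFieldF; letI := T.instAlgebraF; letI := T.instFieldK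
  letI := T.instNumberFieldK; letI := T.instAlgebraK; letI := T.instFieldFbar; letI := T.instAlgebraFbar
  letI := T.instAlgebraKFbar; letI := T.instIsElliptic
  set X := pilotDataOfK T.D T.K with hXdef
  have hl5 : 5 ≤ l := T.D.five_le_l
  have hl0 : 0 < l := by omega
  have hlodd : ¬ 2 ∣ l := by
    intro h
    rcases T.D.l_prime.eq_one_or_self_of_dvd 2 h with h | h <;> omega
  -- the place of `F_tpd = ℚ(√7)` under a fibre point
  let vOf : ∀ pp : Nat.Primes, (thetaIndex X).Fibre (.inr pp) → HeightOneSpectrum (𝓞 K) := fun pp x =>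
    haveI : Fact (pp : ℕ).Prime := ⟨pp.2⟩
    finBelow Broberg.point.F T.F (finBelow T.F T.K (placeOf X pp.1 x))
  -- (F0) a bad fibre point lies over `𝔭₃`, `𝔭₃'` (then `p = 3`) or `𝔭₄₇` (then `p = 47`)
  have hcases : ∀ (pp : Nat.Primes) (x : (thetaIndex X).Fibre (.inr pp)), haveI : Fact (pp : ℕ).Prime := ⟨pp.2⟩
      placeOf X pp.1 x ∈ X.S → ((pp : ℕ) = 3 ∧ (vOf pp x = 𝔭₃ ∨ vOf pp x = 𝔭₃')) ∨ ((pp : ℕ) = 47 ∧ vOf pp x = 𝔭₄₇) := by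
    intro pp x hx
    haveI : Fact (pp : ℕ).Prime := ⟨pp.2⟩
    have hbadv : vOf pp x ∈ Cor22.badPlaces Broberg.point := GenuineK.finBelow_tpd_mem_badPlaces T pp x hx
    have hpv : ((pp : ℕ) : 𝓞 K) ∈ (vOf pp x).asIdeal := GenuineK.natCast_mem_finBelow_tpd T pp x
    obtain ⟨hp2, -⟩ := ne_two_and_ne_l_of_placeOf_mem_S_pilotDataOfK T.D pp x hx
    have hne : (vOf pp x).asIdeal ≠ ⊤ := (vOf pp x).isPrime.ne_top
    have h2v : (2 : 𝓞 K) ∉ (vOf pp x).asIdeal := fun h2 => by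
      haveI : Fact (Nat.Prime 2) := ⟨Nat.prime_two⟩
      exact hp2 (eq_of_natCast_mem_of_prime 2 hne pp.2 hpv (by exact_mod_cast h2))
    rcases Broberg.eq_of_mem_badPlaces (vOf pp x) hbadv h2v with h | h | h
    · haveI : Fact (Nat.Prime 3) := ⟨Nat.prime_three⟩
      have h3 : ((3 : ℕ) : 𝓞 K) ∈ (vOf pp x).asIdeal := by rw [h]; exact_mod_cast three_mem_𝔭₃
      exact Or.inl ⟨eq_of_natCast_mem_of_prime 3 hne pp.2 hpv h3, Or.inl h⟩
    · haveI : Fact (Nat.Prime 3) := ⟨Nat.prime_three⟩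
      have h3 : ((3 : ℕ) : 𝓞 K) ∈ (vOf pp x).asIdeal := by rw [h]; exact_mod_cast three_mem_𝔭₃'
      exact Or.inl ⟨eq_of_natCast_mem_of_prime 3 hne pp.2 hpv h3, Or.inr h⟩
    · haveI : Fact (Nat.Prime 47) := ⟨by norm_num⟩
      have h47 : ((47 : ℕ) : 𝓞 K) ∈ (vOf pp x).asIdeal := by rw [h]; exact_mod_cast fortySeven_mem_𝔭₄₇
      exact Or.inr ⟨eq_of_natCast_mem_of_prime 47 hne pp.2 hpv h47, h⟩
  -- (F1) over a place `v₀` with `e(v₀|p) = 1` and `ord_{v₀} j(λ) = −h`: `e = l·m`, `30 ∣ m·h`, `P_q = e·h/(2l)`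
  have htype : ∀ (pp : Nat.Primes) (x : (thetaIndex X).Fibre (.inr pp)), haveI : Fact (pp : ℕ).Prime := ⟨pp.2⟩
      placeOf X pp.1 x ∈ X.S → ∀ (v₀ : HeightOneSpectrum (𝓞 K)) (h : ℕ), vOf pp x = v₀ → ramIdx K v₀ = 1 →
        ord K v₀ (Cor22.jInv Broberg.lam) = -(h : ℤ) → 0 < h →
        ∃ m : ℕ, absRamificationIdx (pp : ℕ) (kOf X pp.1 x) = l * m ∧ 30 ∣ m * h ∧
          X.qPilot (placeOf X pp.1 x) = (absRamificationIdx (pp : ℕ) (kOf X pp.1 x) : ℝ) * h / (2 * l) := by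
    intro pp x hx v₀ h hv hram hord hh
    haveI : Fact (pp : ℕ).Prime := ⟨pp.2⟩
    obtain ⟨hp2, hpl⟩ := ne_two_and_ne_l_of_placeOf_mem_S_pilotDataOfK T.D pp x hx
    have hram' : ramIdx Broberg.point.F (finBelow Broberg.point.F T.F (finBelow T.F T.K (placeOf X pp.1 x))) = 1 := by
      show ramIdx K (vOf pp x) = 1; rw [hv]; exact hram
    have hord' : ord Broberg.point.F (finBelow Broberg.point.F T.F (finBelow T.F T.K (placeOf X pp.1 x)))
        (Cor22.jInv Broberg.point.x) = -(h : ℤ) := by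
      show ord K (vOf pp x) (Cor22.jInv Broberg.lam) = -(h : ℤ); rw [hv]; exact hord
    obtain ⟨m, hm, h30⟩ := GenuineK.exists_absRamificationIdx_kOf_eq_prime_mul_tpd T pp hp2 hpl x hram' hord' hh
    exact ⟨m, hm, h30, GenuineK.qPilot_placeOf_eq_of_ord_tpd T pp x hx rfl hram' hord'⟩
  -- (F2) `2 ∣ e` over `3`
  have h2e : ∀ (pp : Nat.Primes) (x : (thetaIndex X).Fibre (.inr pp)), haveI : Fact (pp : ℕ).Prime := ⟨pp.2⟩
      (pp : ℕ) = 3 → 2 ∣ absRamificationIdx (pp : ℕ) (kOf X pp.1 x) := by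
    intro pp x hp
    have h := GenuineK.sub_one_dvd_absRamificationIdx_kOf T pp (by rw [hp]; norm_num) x
    have h2 : (pp : ℕ) - 1 = 2 := by omega
    rwa [h2] at h
  -- parity transfer: `2 ∣ l·m ⇒ 2 ∣ m`
  have hpar : ∀ {m : ℕ}, 2 ∣ l * m → 2 ∣ m := fun h =>
    ((Nat.Prime.dvd_mul Nat.prime_two).mp h).resolve_left hlodd
  -- the type map and the per-type indices
  let c : ∀ pp : Nat.Primes, (thetaIndex X).Fibre (.inr pp) → Fin 2 := fun pp x => if vOf pp x = 𝔭₃ then 1 else 0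
  let eAt : Nat.Primes → HeightOneSpectrum (𝓞 K) → ℕ → ℕ := fun pp v₀ d =>
    haveI : Fact (pp : ℕ).Prime := ⟨pp.2⟩
    if h : ∃ x : (thetaIndex X).Fibre (.inr pp), placeOf X pp.1 x ∈ X.S ∧ vOf pp x = v₀
    then absRamificationIdx (pp : ℕ) (kOf X pp.1 h.choose) else d
  have heAt : ∀ (pp : Nat.Primes) (v₀ : HeightOneSpectrum (𝓞 K)) (d : ℕ) (x : (thetaIndex X).Fibre (.inr pp)),
      haveI : Fact (pp : ℕ).Prime := ⟨pp.2⟩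
      placeOf X pp.1 x ∈ X.S → vOf pp x = v₀ → absRamificationIdx (pp : ℕ) (kOf X pp.1 x) = eAt pp v₀ d := by
    intro pp v₀ d x hx hv
    haveI : Fact (pp : ℕ).Prime := ⟨pp.2⟩
    have hex : ∃ x : (thetaIndex X).Fibre (.inr pp), placeOf X pp.1 x ∈ X.S ∧ vOf pp x = v₀ := ⟨x, hx, hv⟩
    have h1 : eAt pp v₀ d = absRamificationIdx (pp : ℕ) (kOf X pp.1 hex.choose) := by simp only [eAt, dif_pos hex]
    rw [h1]
    exact GenuineK.absRamificationIdx_kOf_eq_of_finBelow_tpd_eq T pp x hex.choose (hv.trans hex.choose_spec.2.symm)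
  let p3 : Nat.Primes := ⟨3, Nat.prime_three⟩
  let p47 : Nat.Primes := ⟨47, by norm_num⟩
  haveI : Fact (Nat.Prime (p3 : ℕ)) := ⟨p3.2⟩
  haveI : Fact (Nat.Prime (p47 : ℕ)) := ⟨p47.2⟩
  have h2l : (2 * (l : ℝ)) ≠ 0 := by positivity
  refine ⟨c, eAt p3 𝔭₃' (10 * l), eAt p3 𝔭₃ (30 * l), eAt p47 𝔭₄₇ (15 * l), ?_, ?_, ?_,
    fun pp x hx => (hcases pp x hx).imp (fun h => h.1) (fun h => h.1), ?_, ?_, ?_⟩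
  · -- `10·l ∣ eA`
    by_cases hex : ∃ x : (thetaIndex X).Fibre (.inr p3), placeOf X p3.1 x ∈ X.S ∧ vOf p3 x = 𝔭₃'
    · obtain ⟨x, hx, hv⟩ := hex
      rw [← heAt p3 𝔭₃' (10 * l) x hx hv]
      obtain ⟨m, hm, h30, -⟩ := htype p3 x hx 𝔭₃' 24 hv Broberg.ramIdx_𝔭₃.2 Broberg.ord_jInv_𝔭₃' (by norm_num)
      have h2 := hpar (hm ▸ h2e p3 x rfl)
      have h10 : 10 ∣ m := by omega
      rw [hm, mul_comm 10 l]
      exact mul_dvd_mul_left l h10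
    · simp only [eAt, dif_neg hex]; exact dvd_rfl
  · -- `30·l ∣ eB`
    by_cases hex : ∃ x : (thetaIndex X).Fibre (.inr p3), placeOf X p3.1 x ∈ X.S ∧ vOf p3 x = 𝔭₃
    · obtain ⟨x, hx, hv⟩ := hex
      rw [← heAt p3 𝔭₃ (30 * l) x hx hv]
      obtain ⟨m, hm, h30, -⟩ := htype p3 x hx 𝔭₃ 2 hv Broberg.ramIdx_𝔭₃.1 Broberg.ord_jInv_𝔭₃ (by norm_num)
      have h2 := hpar (hm ▸ h2e p3 x rfl)
      have h30' : 30 ∣ m := by omega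
      rw [hm, mul_comm 30 l]
      exact mul_dvd_mul_left l h30'
    · simp only [eAt, dif_neg hex]; exact dvd_rfl
  · -- `15·l ∣ eC`
    by_cases hex : ∃ x : (thetaIndex X).Fibre (.inr p47), placeOf X p47.1 x ∈ X.S ∧ vOf p47 x = 𝔭₄₇
    · obtain ⟨x, hx, hv⟩ := hex
      rw [← heAt p47 𝔭₄₇ (15 * l) x hx hv]
      obtain ⟨m, hm, h30, -⟩ := htype p47 x hx 𝔭₄₇ 8 hv Broberg.ramIdx_𝔭₄₇ Broberg.ord_jInv_𝔭₄₇ (by norm_num)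
      have h15 : 15 ∣ m := by omega
      rw [hm, mul_comm 15 l]
      exact mul_dvd_mul_left l h15
    · simp only [eAt, dif_neg hex]; exact dvd_rfl
  · -- `h3`
    intro pp x hp hx
    have hpp : pp = p3 := Subtype.ext hp
    subst hpp
    have hv : vOf p3 x = 𝔭₃ ∨ vOf p3 x = 𝔭₃' := by
      rcases hcases p3 x hx with h | h
      · exact h.2
      · exact absurd h.1 (by norm_num)
    constructor
    · intro hc
      have hv' : vOf p3 x = 𝔭₃' := by
        rcases hv with h | h
        · exact absurd hc (by simp only [c, if_pos h]; decide)
        · exact h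
      obtain ⟨m, hm, -, hP⟩ := htype p3 x hx 𝔭₃' 24 hv' Broberg.ramIdx_𝔭₃.2 Broberg.ord_jInv_𝔭₃' (by norm_num)
      refine ⟨heAt p3 𝔭₃' (10 * l) x hx hv', ?_⟩
      rw [hP, ← heAt p3 𝔭₃' (10 * l) x hx hv', hm, show 12 * (l * m) / l = 12 * m by
        rw [mul_left_comm, Nat.mul_div_cancel_left _ hl0], div_eq_iff h2l]
      push_cast
      ring
    · intro hc
      have hv' : vOf p3 x = 𝔭₃ := by
        rcases hv with h | h
        · exact h
        · exact absurd hc (by simp only [c, if_neg (h.symm ▸ 𝔭₃_ne_𝔭₃'.symm : vOf p3 x ≠ 𝔭₃)]; decide)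
      obtain ⟨m, hm, -, hP⟩ := htype p3 x hx 𝔭₃ 2 hv' Broberg.ramIdx_𝔭₃.1 Broberg.ord_jInv_𝔭₃ (by norm_num)
      refine ⟨heAt p3 𝔭₃ (30 * l) x hx hv', ?_⟩
      rw [hP, ← heAt p3 𝔭₃ (30 * l) x hx hv', hm, Nat.mul_div_cancel_left _ hl0, div_eq_iff h2l]
      push_cast
      ring
  · -- `h47`
    intro pp x hp hx
    have hpp : pp = p47 := Subtype.ext hp
    subst hpp
    have hv : vOf p47 x = 𝔭₄₇ := by
      rcases hcases p47 x hx with h | h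
      · exact absurd h.1 (by norm_num)
      · exact h.2
    obtain ⟨m, hm, -, hP⟩ := htype p47 x hx 𝔭₄₇ 8 hv Broberg.ramIdx_𝔭₄₇ Broberg.ord_jInv_𝔭₄₇ (by norm_num)
    refine ⟨by simp only [c, if_neg (hv.symm ▸ Broberg.𝔭₄₇_ne.1 : vOf p47 x ≠ 𝔭₃)], heAt p47 𝔭₄₇ (15 * l) x hx hv, ?_⟩
    rw [hP, ← heAt p47 𝔭₄₇ (15 * l) x hx hv, hm, show 4 * (l * m) / l = 4 * m by
      rw [mul_left_comm, Nat.mul_div_cancel_left _ hl0], div_eq_iff h2l]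
    push_cast
    ring
  · -- `hiso`
    intro pp x y hx hy hc
    haveI : Fact (pp : ℕ).Prime := ⟨pp.2⟩
    have hv : vOf pp x = vOf pp y := by
      rcases hcases pp x hx with ⟨hp, hvx⟩ | ⟨hp, hvx⟩
      · have hvy : vOf pp y = 𝔭₃ ∨ vOf pp y = 𝔭₃' := by
          rcases hcases pp y hy with ⟨-, h⟩ | ⟨hp', -⟩
          · exact h
          · exact absurd (hp.symm.trans hp') (by norm_num)
        by_cases hx3 : vOf pp x = 𝔭₃
        · have hy3 : vOf pp y = 𝔭₃ := by
            by_contra hne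
            exact absurd hc (by simp only [c, if_pos hx3, if_neg hne]; decide)
          rw [hx3, hy3]
        · have hy3 : vOf pp y ≠ 𝔭₃ := by
            intro hy3
            exact absurd hc (by simp only [c, if_neg hx3, if_pos hy3]; decide)
          rw [hvx.resolve_left hx3, hvy.resolve_left hy3]
      · have hvy : vOf pp y = 𝔭₄₇ := by
          rcases hcases pp y hy with ⟨hp', -⟩ | ⟨-, h⟩
          · exact absurd (hp.symm.trans hp') (by norm_num)
          · exact h
        rw [hvx, hvy]
    exact GenuineK.nonempty_algEquiv_kOf_of_finBelow_tpd_eq T pp x y hv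

end Summit.ABC.IUTFork.Conditional

end
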